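import Summits.Ventures.CertifiedManyBodySolver.Transport.PauliMarkovMatrixRows
import HarnessLib

/-!
# Ventures/CertifiedManyBodySolver — Transport/PauliMarkovMatrixBody.lean

HONEST FRAMING: first certified bounds; not a superconductivity verdict; every number certified or labelled float.

Linear algebra of the PMP body `0 ⪯ M ⪯ C(ν)`, `C(ν) = [1 ν; ν ν]` (op-02 `HOME/op/PM-2D.md` §7.4, "SUPPORT
FUNCTION in closed form"; consumer `Transport/PauliMarkovMatrixSigma.lean`): **the closed form is a majorant**,

  `Re tr(Y M) ≤ σ₂(τ, δ) := ((τ + √(τ² − 4δ))/2)₊ + ((τ − √(τ² − 4δ))/2)₊`,  `τ = Re tr(C(ν) Y)`,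
  `δ = Re(det C(ν) det Y)`,

for Hermitian `2 × 2` `Y`, `ν ∈ [0, 1]` and every `M` with `0 ⪯ M ⪯ C(ν)` (`re_trace_mul_le_sigmaTwo`; the two
arguments of `σ₂` are the sum and product of the eigenvalues of `C^{1/2} Y C^{1/2}`, so `σ₂ = (μ₁)₊ + (μ₂)₊` —
op-02's `σ_C = τ` if `δ ≥ 0 ∧ τ ≥ 0`, `0` if `δ ≥ 0 ∧ τ ≤ 0`, `(τ + √(τ² − 4δ))/2` if `δ < 0`).

PROOF. §1: for Hermitian `Z` and `0 ⪯ N ⪯ 1` (any size), `Re tr(Z N) = Σ_i λ_i (U⋆NU)_{ii} ≤ Σ_i (λ_i)₊` by the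
spectral theorem (`Matrix.IsHermitian.spectral_theorem`) and `(U⋆NU)_{ii} ∈ [0, 1]`
(`re_trace_mul_le_sum_posPart_eigenvalues`). §2: for `2 × 2`, `Σ_i (λ_i)₊ = σ₂(tr Z, det Z)` (`sigmaTwo`); a
factorisation `C = L Lᴴ` with `L` invertible transports `0 ⪯ M ⪯ C` to `0 ⪯ L⁻¹ M L⁻ᴴ ⪯ 1` with
`tr(Y M) = tr((Lᴴ Y L)(L⁻¹ M L⁻ᴴ))`, `tr(Lᴴ Y L) = tr(C Y)`, `det(Lᴴ Y L) = det C det Y`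
(`re_trace_mul_le_sigmaTwo_of_factor`); the explicit Cholesky factor of the regularised `C(ν) + ε 𝟙`
(`cholReg`, `ε > 0`) and continuity of `σ₂` as `ε → 0⁺` give the claim for the possibly singular `C(ν)`.

Pure linear algebra; no physical notion (abbreviations `sigmaTwo`, `pmpConstReg`, `cholReg`), no named fact,
no sorry; axioms standard.

References: op-02 PM-2D.md §7.4; R. Bhatia, *Matrix Analysis* (Springer GTM 169, 1997) Ch. III (only the
elementary diagonal-pinching argument is used).
-/

noncomputable section

namespace Summit.Ventures.CertifiedManyBodySolver.Transport

open Matrix Finset MeasureTheory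
open Literature.Probability.LatticeModels
open Literature.MathematicalPhysics.QuantumLattice HubbardWave0
open scoped ComplexOrder Real

variable {d : ℕ}

/-! ### §1. `Re tr(Z N) ≤ Σ_i (λ_i(Z))₊` for Hermitian `Z` and `0 ⪯ N ⪯ 1` -/

section UnitInterval

variable {n : Type*} [DecidableEq n]

/-- Diagonal entries of `N` with `0 ⪯ N ⪯ 1` are real numbers in `[0, 1]`. -/
theorem apply_self_mem_of_posSemidef {N : Matrix n n ℂ} (hN : N.PosSemidef) (hN1 : (1 - N).PosSemidef)
    (i : n) : (N i i).im = 0 ∧ 0 ≤ (N i i).re ∧ (N i i).re ≤ 1 := by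
  have h0 := Complex.nonneg_iff.1 (hN.diag_nonneg (i := i))
  have h1 := Complex.nonneg_iff.1 (hN1.diag_nonneg (i := i))
  simp only [Matrix.sub_apply, Matrix.one_apply_eq, Complex.sub_re, Complex.one_re] at h1
  exact ⟨h0.2.symm, h0.1, by linarith [h1.1]⟩

variable [Fintype n]

/-- **Diagonal pinching bound.** For Hermitian `Z` and `0 ⪯ N ⪯ 1`: `Re tr(Z N) ≤ Σ_i max(λ_i(Z), 0)`
(spectral theorem: `tr(Z N) = Σ_i λ_i (U⋆ N U)_{ii}` with `(U⋆ N U)_{ii} ∈ [0, 1]`). -/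
theorem re_trace_mul_le_sum_posPart_eigenvalues {Z N : Matrix n n ℂ} (hZ : Z.IsHermitian)
    (hN : N.PosSemidef) (hN1 : (1 - N).PosSemidef) :
    ((Z * N).trace).re ≤ ∑ i, max (hZ.eigenvalues i) 0 := by
  set U : Matrix n n ℂ := (hZ.eigenvectorUnitary : Matrix n n ℂ) with hU
  have hUU : star U * U = 1 := Unitary.star_mul_self_of_mem hZ.eigenvectorUnitary.prop
  -- `N' = U⋆ N U` is again in `[0, 1]`
  have hN'0 : (star U * N * U).PosSemidef := by
    have h := hN.conjTranspose_mul_mul_same U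
    rwa [← Matrix.star_eq_conjTranspose] at h
  have hN'1 : (1 - star U * N * U).PosSemidef := by
    have h := hN1.conjTranspose_mul_mul_same U
    rw [← Matrix.star_eq_conjTranspose, Matrix.mul_sub, Matrix.sub_mul, Matrix.mul_one, hUU] at h
    exact h
  -- `tr(Z N) = tr(D N')`
  have hZD : Z = U * diagonal (fun i => (hZ.eigenvalues i : ℂ)) * star U := by
    conv_lhs => rw [hZ.spectral_theorem, Unitary.conjStarAlgAut_apply]
    rfl
  have htr : (Z * N).trace = (diagonal (fun i => (hZ.eigenvalues i : ℂ)) * (star U * N * U)).trace := by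
    conv_lhs => rw [hZD]
    rw [Matrix.mul_assoc (U * _) (star U) N, Matrix.mul_assoc U _ (star U * N), Matrix.trace_mul_comm U _,
      Matrix.mul_assoc _ (star U * N) U]
  rw [htr, Matrix.trace, Complex.re_sum]
  refine Finset.sum_le_sum fun i _ => ?_
  rw [Matrix.diag_apply, Matrix.diagonal_mul, Complex.re_ofReal_mul]
  obtain ⟨-, h0, h1⟩ := apply_self_mem_of_posSemidef hN'0 hN'1 i
  exact mul_le_max_of_mem_Icc _ _ h0 h1

end UnitInterval

/-! ### §2. The `2 × 2` closed form `σ₂` and the Cholesky transfer -/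

section TwoByTwo

/-- **`σ₂(t, D) = ((t + √(t² − 4D))/2)₊ + ((t − √(t² − 4D))/2)₊`**: the sum of the positive parts of the
two roots of `μ² − t μ + D` (when they are real). -/
def sigmaTwo (t D : ℝ) : ℝ :=
  max ((t + Real.sqrt (t ^ 2 - 4 * D)) / 2) 0 + max ((t - Real.sqrt (t ^ 2 - 4 * D)) / 2) 0

/-- `σ₂(a + b, a b) = a₊ + b₊`. -/
theorem sigmaTwo_add_mul (a b : ℝ) : sigmaTwo (a + b) (a * b) = max a 0 + max b 0 := by
  unfold sigmaTwo
  have hq : (a + b) ^ 2 - 4 * (a * b) = (a - b) ^ 2 := by ring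
  rw [hq, Real.sqrt_sq_eq_abs]
  rcases le_total a b with hab | hab
  · rw [abs_of_nonpos (sub_nonpos.2 hab)]
    have h1 : (a + b + -(a - b)) / 2 = b := by ring
    have h2 : (a + b - -(a - b)) / 2 = a := by ring
    rw [h1, h2, add_comm]
  · rw [abs_of_nonneg (sub_nonneg.2 hab)]
    have h1 : (a + b + (a - b)) / 2 = a := by ring
    have h2 : (a + b - (a - b)) / 2 = b := by ring
    rw [h1, h2]

/-- `σ₂` is (jointly) continuous. -/
theorem continuous_sigmaTwo : Continuous fun p : ℝ × ℝ => sigmaTwo p.1 p.2 := by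
  unfold sigmaTwo
  have hq : Continuous fun p : ℝ × ℝ => Real.sqrt (p.1 ^ 2 - 4 * p.2) :=
    Real.continuous_sqrt.comp (by fun_prop)
  exact (((continuous_fst.add hq).div_const 2).max continuous_const).add
    (((continuous_fst.sub hq).div_const 2).max continuous_const)

/-- For a Hermitian `2 × 2` matrix: `Σ_i (λ_i)₊ = σ₂(Re tr Z, Re det Z)`. -/
theorem sum_posPart_eigenvalues_eq_sigmaTwo {Z : Matrix (Fin 2) (Fin 2) ℂ} (hZ : Z.IsHermitian) :
    ∑ i, max (hZ.eigenvalues i) 0 = sigmaTwo (Z.trace.re) (Z.det.re) := by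
  have htr : Z.trace.re = hZ.eigenvalues 0 + hZ.eigenvalues 1 := by
    rw [hZ.trace_eq_sum_eigenvalues, Fin.sum_univ_two]
    simp
  have hdet : Z.det.re = hZ.eigenvalues 0 * hZ.eigenvalues 1 := by
    rw [hZ.det_eq_prod_eigenvalues, Fin.prod_univ_two]
    simp
  rw [htr, hdet, sigmaTwo_add_mul, Fin.sum_univ_two]

variable {n : Type*} [Fintype n] [DecidableEq n]

/-- **Cholesky transfer.** If `C = L Lᴴ` with `L` invertible and `0 ⪯ M ⪯ C`, then for Hermitian `Y`:
`Re tr(Y M) ≤ Σ_i (λ_i(Lᴴ Y L))₊` (substitute `M = L N Lᴴ`, `0 ⪯ N = L⁻¹ M L⁻ᴴ ⪯ 1`). -/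
theorem re_trace_mul_le_sum_posPart_eigenvalues_of_factor {Y M C L : Matrix n n ℂ} (hY : Y.IsHermitian)
    (hC : L * Lᴴ = C) (hL : IsUnit L.det) (hM : M.PosSemidef) (hCM : (C - M).PosSemidef) :
    ((Y * M).trace).re ≤ ∑ i, max ((isHermitian_conjTranspose_mul_mul L hY).eigenvalues i) 0 := by
  have h1 : L⁻¹ * L = 1 := Matrix.nonsing_inv_mul L hL
  have h2 : L * L⁻¹ = 1 := Matrix.mul_nonsing_inv L hL
  have h2' : (L⁻¹)ᴴ * Lᴴ = 1 := by rw [← Matrix.conjTranspose_mul, h2, Matrix.conjTranspose_one]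
  have h1' : Lᴴ * (L⁻¹)ᴴ = 1 := by rw [← Matrix.conjTranspose_mul, h1, Matrix.conjTranspose_one]
  have hN0 : (L⁻¹ * M * (L⁻¹)ᴴ).PosSemidef := hM.mul_mul_conjTranspose_same L⁻¹
  have hN1 : (1 - L⁻¹ * M * (L⁻¹)ᴴ).PosSemidef := by
    have h := hCM.mul_mul_conjTranspose_same L⁻¹
    rw [Matrix.mul_sub, Matrix.sub_mul, ← hC, ← Matrix.mul_assoc, h1, Matrix.one_mul, h1'] at h
    exact h
  have hM' : M = L * (L⁻¹ * M * (L⁻¹)ᴴ) * Lᴴ := by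
    rw [← Matrix.mul_assoc, ← Matrix.mul_assoc, h2, Matrix.one_mul, Matrix.mul_assoc, h2', Matrix.mul_one]
  have htr : (Y * M).trace = (Lᴴ * Y * L * (L⁻¹ * M * (L⁻¹)ᴴ)).trace := by
    conv_lhs => rw [hM']
    rw [← Matrix.mul_assoc, Matrix.trace_mul_comm, ← Matrix.mul_assoc, ← Matrix.mul_assoc]
  rw [htr]
  exact re_trace_mul_le_sum_posPart_eigenvalues _ hN0 hN1

/-- The `2 × 2` case in closed form: `Re tr(Y M) ≤ σ₂(Re tr(C Y), Re(det C det Y))`. -/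
theorem re_trace_mul_le_sigmaTwo_of_factor {Y M C L : Matrix (Fin 2) (Fin 2) ℂ} (hY : Y.IsHermitian)
    (hC : L * Lᴴ = C) (hL : IsUnit L.det) (hM : M.PosSemidef) (hCM : (C - M).PosSemidef) :
    ((Y * M).trace).re ≤ sigmaTwo ((C * Y).trace.re) ((C.det * Y.det).re) := by
  have h := re_trace_mul_le_sum_posPart_eigenvalues_of_factor hY hC hL hM hCM
  rw [sum_posPart_eigenvalues_eq_sigmaTwo, Matrix.trace_mul_cycle, hC] at h
  have hdet : (Lᴴ * Y * L).det = C.det * Y.det := by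
    rw [Matrix.det_mul, Matrix.det_mul, ← hC, Matrix.det_mul]
    ring
  rwa [hdet] at h

/-- The regularised constant matrix `C(ν) + ε 𝟙 = [1+ε ν; ν ν+ε]`. -/
def pmpConstReg (ν ε : ℝ) : Matrix (Fin 2) (Fin 2) ℂ := pmpConst ν + diagonal fun _ => ((ε : ℝ) : ℂ)

/-- **Explicit Cholesky factor** of `C(ν) + ε 𝟙`: `L = [√(1+ε) 0; ν/√(1+ε) √(ν + ε − ν²/(1+ε))]`. -/
def cholReg (ν ε : ℝ) : Matrix (Fin 2) (Fin 2) ℂ :=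
  !![((Real.sqrt (1 + ε) : ℝ) : ℂ), 0;
     ((ν / Real.sqrt (1 + ε) : ℝ) : ℂ), ((Real.sqrt (ν + ε - ν ^ 2 / (1 + ε)) : ℝ) : ℂ)]

/-- The Schur complement `ν + ε − ν²/(1+ε)` is positive for `ν ∈ [0, 1]`, `ε > 0`. -/
theorem schurReg_pos {ν ε : ℝ} (hν0 : 0 ≤ ν) (hν1 : ν ≤ 1) (hε : 0 < ε) : 0 < ν + ε - ν ^ 2 / (1 + ε) := by
  have ha : 0 < 1 + ε := by linarith
  have hkey : ν ^ 2 / (1 + ε) ≤ ν ^ 2 := div_le_self (sq_nonneg ν) (by linarith)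
  nlinarith [mul_nonneg hν0 (sub_nonneg.2 hν1)]

/-- `L Lᴴ = C(ν) + ε 𝟙`. -/
theorem cholReg_mul_conjTranspose {ν ε : ℝ} (hν0 : 0 ≤ ν) (hν1 : ν ≤ 1) (hε : 0 < ε) :
    cholReg ν ε * (cholReg ν ε)ᴴ = pmpConstReg ν ε := by
  have ha : 0 < 1 + ε := by linarith
  have hs : 0 < Real.sqrt (1 + ε) := Real.sqrt_pos.2 ha
  have hg : 0 ≤ ν + ε - ν ^ 2 / (1 + ε) := (schurReg_pos hν0 hν1 hε).le
  have e00 : Real.sqrt (1 + ε) * Real.sqrt (1 + ε) = 1 + ε := Real.mul_self_sqrt ha.le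
  have e01 : Real.sqrt (1 + ε) * (ν / Real.sqrt (1 + ε)) = ν := by field_simp
  have e10 : ν / Real.sqrt (1 + ε) * Real.sqrt (1 + ε) = ν := by field_simp
  have e11 : ν / Real.sqrt (1 + ε) * (ν / Real.sqrt (1 + ε)) +
      Real.sqrt (ν + ε - ν ^ 2 / (1 + ε)) * Real.sqrt (ν + ε - ν ^ 2 / (1 + ε)) = ν + ε := by
    rw [Real.mul_self_sqrt hg, div_mul_div_comm, e00]
    ring
  ext i j
  fin_cases i <;> fin_cases j
  · simp only [cholReg, pmpConstReg, pmpConst, Matrix.mul_apply, Matrix.conjTranspose_apply, Fin.sum_univ_two]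
    simp [Complex.ext_iff, e00]
  · simp only [cholReg, pmpConstReg, pmpConst, Matrix.mul_apply, Matrix.conjTranspose_apply, Fin.sum_univ_two]
    simp [Complex.ext_iff, e01]
  · simp only [cholReg, pmpConstReg, pmpConst, Matrix.mul_apply, Matrix.conjTranspose_apply, Fin.sum_univ_two]
    simp [Complex.ext_iff, e10]
  · simp only [cholReg, pmpConstReg, pmpConst, Matrix.mul_apply, Matrix.conjTranspose_apply, Fin.sum_univ_two]
    simp [Complex.ext_iff, e11]

/-- `det L ≠ 0`. -/
theorem isUnit_det_cholReg {ν ε : ℝ} (hν0 : 0 ≤ ν) (hν1 : ν ≤ 1) (hε : 0 < ε) : IsUnit (cholReg ν ε).det := by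
  rw [isUnit_iff_ne_zero, cholReg, Matrix.det_fin_two_of]
  have hs : 0 < Real.sqrt (1 + ε) := Real.sqrt_pos.2 (by linarith)
  have hg : 0 < Real.sqrt (ν + ε - ν ^ 2 / (1 + ε)) := Real.sqrt_pos.2 (schurReg_pos hν0 hν1 hε)
  rw [zero_mul, sub_zero, ← Complex.ofReal_mul, Complex.ofReal_ne_zero]
  positivity

/-- `C(ν) + ε 𝟙 − M ⪰ 0` whenever `C(ν) − M ⪰ 0` and `ε ≥ 0`. -/
theorem posSemidef_pmpConstReg_sub {ν ε : ℝ} (hε : 0 ≤ ε) {M : Matrix (Fin 2) (Fin 2) ℂ}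
    (hM : (pmpConst ν - M).PosSemidef) : (pmpConstReg ν ε - M).PosSemidef := by
  rw [pmpConstReg, add_sub_right_comm]
  exact hM.add (Matrix.PosSemidef.diagonal fun _ => Complex.zero_le_real.2 hε)

/-- `ε ↦ C(ν) + ε 𝟙` is continuous. -/
theorem continuous_pmpConstReg (ν : ℝ) : Continuous (pmpConstReg ν) := by
  unfold pmpConstReg
  refine continuous_const.add ?_
  refine continuous_matrix fun i j => ?_
  by_cases h : i = j
  · subst h
    simp only [Matrix.diagonal_apply_eq]
    exact Complex.continuous_ofReal
  · simp only [Matrix.diagonal_apply_ne _ h]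
    exact continuous_const

/-- `C(ν) + 0 · 𝟙 = C(ν)`. -/
theorem pmpConstReg_zero (ν : ℝ) : pmpConstReg ν 0 = pmpConst ν := by
  rw [pmpConstReg, Complex.ofReal_zero]
  have : (diagonal fun _ : Fin 2 => (0 : ℂ)) = 0 := diagonal_zero
  rw [this, add_zero]

/-- **The closed form is a majorant on the body `0 ⪯ M ⪯ C(ν)`** (`ν ∈ [0, 1]`, Hermitian `Y`):
`Re tr(Y M) ≤ σ₂(Re tr(C(ν) Y), Re(det C(ν) det Y))` — Cholesky transfer for `C(ν) + ε 𝟙`, `ε → 0⁺`. -/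
theorem re_trace_mul_le_sigmaTwo {ν : ℝ} (hν0 : 0 ≤ ν) (hν1 : ν ≤ 1) {Y M : Matrix (Fin 2) (Fin 2) ℂ}
    (hY : Y.IsHermitian) (hM : PMPFeasible ν M) :
    ((Y * M).trace).re ≤ sigmaTwo ((pmpConst ν * Y).trace.re) (((pmpConst ν).det * Y.det).re) := by
  -- the regularised bounds
  obtain ⟨f, hf⟩ : ∃ f : ℝ → ℝ, f = fun ε =>
      sigmaTwo ((pmpConstReg ν ε * Y).trace.re) (((pmpConstReg ν ε).det * Y.det).re) := ⟨_, rfl⟩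
  have hle : ∀ ε : ℝ, 0 < ε → ((Y * M).trace).re ≤ f ε := fun ε hε => by
    rw [hf]
    exact re_trace_mul_le_sigmaTwo_of_factor hY (cholReg_mul_conjTranspose hν0 hν1 hε)
      (isUnit_det_cholReg hν0 hν1 hε) hM.1 (posSemidef_pmpConstReg_sub hε.le hM.2)
  -- continuity in `ε`
  have hcont : Continuous f := by
    rw [hf]
    have h1 : Continuous fun ε => ((pmpConstReg ν ε * Y).trace).re :=
      Complex.continuous_re.comp (((continuous_pmpConstReg ν).mul continuous_const).matrix_trace)
    have h2 : Continuous fun ε => ((pmpConstReg ν ε).det * Y.det).re :=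
      Complex.continuous_re.comp (((continuous_pmpConstReg ν).matrix_det).mul continuous_const)
    exact continuous_sigmaTwo.comp (h1.prodMk h2)
  have hlim : Filter.Tendsto f (nhdsWithin 0 (Set.Ioi 0)) (nhds (f 0)) :=
    (hcont.tendsto 0).mono_left nhdsWithin_le_nhds
  have h0 : f 0 = sigmaTwo ((pmpConst ν * Y).trace.re) (((pmpConst ν).det * Y.det).re) := by
    rw [hf]
    simp only [pmpConstReg_zero]
  rw [← h0]
  exact ge_of_tendsto hlim (eventually_nhdsWithin_of_forall fun ε hε => hle ε hε)

end TwoByTwo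

end Summit.Ventures.CertifiedManyBodySolver.Transport

end
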